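import Summits.ResolutionOfSingularities.ResolutionOfSingularities.Theorems.EquisingularLiftEquisingularLiftNatEmbeddedLiftLocalExistence
import HarnessLib

/-!
# [OURS · L1 W4.5(b) · EL♮(3) · (T-k) · J1c brick B4, ring core] The chart-local lift in the LIFT CURRENCY of J1b (`I' ⊔ JA' = K`)

Crux EL♮(3) = stmt-ResolutionOfSingularities-20148; NEED-FACT of record J1 = `EmbeddedInfinitesimalLiftFact` (p596985), reduced by res-type-027 g16 to the
chart form `EmbeddedInfinitesimalChartLiftFact` (p603689). Written by res-L1-w45b-stub-4 g10 on res-L1-w45b-plan-1 g19's R5 (ii) (brick B4 = (λ♯) of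
`L/res-type-027/J1c-DESIGN-v2.md` §2, 5a0a95bce22e50fb). OURS; NOT a statement of H. Hironaka's 2017 manuscript; AI-written, weaker than expert review.
No `sorry`; standard axioms; DEF-FREE. `--supports stmt-ResolutionOfSingularities-20148 --as helper`.

WHAT. (λ) `exists_flat_lift_eq_of_isWeaklyRegular_fiber` (p601260) speaks of an ideal `I` of the quotient ring `A' ⧸ JA'` (the previous level); the
patching engine B6 and the chart clause of `EmbeddedInfinitesimalChartLiftFact` speak of ideals of `A' = Γ(Wₙ₊₁, U)` itself: the ideal `K ⊇ JA'` of
`Yₙ` in the chart (kernel of `Γ(Wₙ₊₁, U) → Γ(Yₙ, ·)`) and a LIFT `I' ≤ A'` with `A' ⧸ I'` flat over `C'` and `I' ⊔ JA' = K` (J1b's currency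
`I' ⊔ (ε) = K`, …NatEmbeddedLiftDifferenceClass). This file is the two-line bridge:
* `exists_flat_lift_sup_eq_of_isWeaklyRegular_fiber` — `K ⊇ JA'` with `(A'/JA') ⧸ K̄` flat over `C'/J`, a list `a' ⊆ K` weakly regular on the
  fibre `A'/𝔪A'` generating `K` modulo `𝔪` ⟹ `A' ⧸ (a')` flat over `C'` and `(a') ⊔ JA' = K`.
* `map_quotient_mk_eq_ker_of_sup_eq` — the chart clause: if `I' ⊔ ker φ = K` for a surjective `φ : A' → B` then `I'.map φ = K.map φ`; with
  `K = φ⁻¹(ker ψ)` this is `I'·B = ker ψ` (the shape `(C.ideal U).map (t.app U) = ker (jn.app (t⁻¹U))`).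
-/

set_option linter.dupNamespace false

noncomputable section

open IsLocalRing RingTheory.Sequence

namespace Summit.ResolutionOfSingularities.ResolutionOfSingularities.Cruxes.EquisingularLiftNat.Sections

universe u v w

variable {C' : Type u} [CommRing C'] [IsLocalRing C'] [IsArtinianRing C'] {A' : Type v} [CommRing A'] [Algebra C' A'] [Module.Flat C' A']

/-- **B4, ring core — the chart-local lift in the lift currency.** `J ≤ 𝔪` the previous level, `K ⊇ JA'` the ideal of `Yₙ` in the chart ring `A'`
(so that `(A'/JA') ⧸ K̄` = the chart ring of `Yₙ`, flat over `C'/J`), `a' ⊆ K` weakly regular on the fibre and generating `K` modulo `𝔪`: then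
`I' := (a')` is a lift — `A' ⧸ I'` flat over `C'`, `I' ⊔ JA' = K`. [cite: Hartshorne2010, Thm. 9.2 (b), (c)] [OURS · L1 W4.5b · J1c B4] toward
`stub_elnat_embeddedInfinitesimalLiftFact`; NOT a statement of the manuscript. -/
theorem exists_flat_lift_sup_eq_of_isWeaklyRegular_fiber (J : Ideal C') (hJ : J ≤ maximalIdeal C') (K : Ideal A')
    (hJK : J.map (algebraMap C' A') ≤ K)
    [Module.Flat (C' ⧸ J) ((A' ⧸ J.map (algebraMap C' A')) ⧸ K.map (Ideal.Quotient.mk (J.map (algebraMap C' A'))))]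
    (as' : List A') (hreg : IsWeaklyRegular (A' ⧸ (maximalIdeal C').map (algebraMap C' A')) as')
    (hmem : ∀ a ∈ as', a ∈ K) (hgen : K ≤ Ideal.ofList as' ⊔ (maximalIdeal C').map (algebraMap C' A')) :
    Module.Flat C' (A' ⧸ Ideal.ofList as') ∧ Ideal.ofList as' ⊔ J.map (algebraMap C' A') = K := by
  set π := Ideal.Quotient.mk (J.map (algebraMap C' A')) with hπ
  have hgen' : K.map π ≤ (Ideal.ofList as').map π ⊔ (maximalIdeal C').map (algebraMap C' (A' ⧸ J.map (algebraMap C' A'))) := by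
    have h1 : K.map π ≤ (Ideal.ofList as' ⊔ (maximalIdeal C').map (algebraMap C' A')).map π := Ideal.map_mono hgen
    rw [Ideal.map_sup, Ideal.map_map] at h1
    exact h1
  obtain ⟨hflat, heq⟩ := exists_flat_lift_eq_of_isWeaklyRegular_fiber J hJ (K.map π) as' hreg
    (fun a ha => Ideal.mem_map_of_mem _ (hmem a ha)) hgen'
  refine ⟨hflat, ?_⟩
  -- pull `(a')·(A'/JA') = K·(A'/JA')` back along the surjection `π` (kernel `JA' ≤ K`)
  have h := congrArg (Ideal.comap π) heq
  rwa [Ideal.comap_map_of_surjective _ Ideal.Quotient.mk_surjective, Ideal.comap_map_of_surjective _ Ideal.Quotient.mk_surjective,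
    ← RingHom.ker_eq_comap_bot, Ideal.mk_ker, sup_eq_left.mpr hJK] at h

omit [IsLocalRing C'] [IsArtinianRing C'] [Algebra C' A'] [Module.Flat C' A'] in
/-- **The chart clause from the lift identity.** For a surjection `φ : A' → B` and ideals `I' K ≤ A'` with `I' ⊔ ker φ = K`: `I'.map φ = K.map φ`;
in particular, if `K = (ker ψ).comap φ` for `ψ : B → D`, then `I'.map φ = ker ψ` (the shape `(C.ideal U)·Γ(Wₙ, t⁻¹U) = ker (jn.app (t⁻¹U))` of
`EmbeddedInfinitesimalChartLiftFact`). [folklore] -/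
theorem map_eq_ker_of_sup_ker_eq_comap {B : Type w} [CommRing B] {D : Type*} [CommRing D] (φ : A' →+* B) (hφ : Function.Surjective φ)
    (ψ : B →+* D) (I' : Ideal A') (h : I' ⊔ RingHom.ker φ = (RingHom.ker ψ).comap φ) : I'.map φ = RingHom.ker ψ := by
  have h1 : (I' ⊔ RingHom.ker φ).map φ = ((RingHom.ker ψ).comap φ).map φ := by rw [h]
  have h2 : (RingHom.ker φ).map φ = ⊥ := (Ideal.map_eq_bot_iff_le_ker φ).mpr le_rfl
  rwa [Ideal.map_sup, h2, sup_bot_eq, Ideal.map_comap_of_surjective _ hφ] at h1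

end Summit.ResolutionOfSingularities.ResolutionOfSingularities.Cruxes.EquisingularLiftNat.Sections

end
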